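import Literature.NumberTheory.Transcendental.KZIntervalPeriodProofs
import Literature.NumberTheory.Transcendental.SemialgebraicLineDeriv
import Literature.NumberTheory.Transcendental.KZCubicalCalculus
import Mathlib.Analysis.Calculus.Deriv.Inv
import Mathlib.Analysis.Calculus.Deriv.Mul

/-!
# `StokesGeneration` (stmt-KontsevichZagierPeriods-3586) — line `fibrewise_stokes`, stub `stub_rungCertificate`

Registered rung stub R2 of the line `fibrewise_stokes` of the crux `StokesGeneration` (route
UnfoldedStokes): **the two-element divergence certificate for a logarithmic derivative** on the
closed square `[0,1]²` (coordinates `z = x 0`, `y = x 1`).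

Let `P` be positive on `[0,1]` with `P 0 = P 1 = 1`, continuous on `[0,1]` together with `P'`,
differentiable on `(0,1)` with derivative `P'`, both `ℚ`-semialgebraic as functions of `x 0` on the
square, and let `γ` be real algebraic. With `E = 1 + (P z − 1) y = (1 − y) + y P z > 0` on the square,
the two primitives
`G₀ = γ (P z − 1)/E` (direction `0`), `G₁ = γ y P'(z) (1/P z − 1/E)` (direction `1`)
have fibre derivatives `D₀ = γ P'(z)/E²`, `D₁ = γ P'(z) (1/P z − 1/E²)` with `D₀ + D₁ = γ P'/P`, and
ALL four boundary values `G₀|_{z=1}`, `G₀|_{z=0}`, `G₁|_{y=1}`, `G₁|_{y=0}` vanish identically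
(`P 0 = P 1 = 1`, and `E|_{y=1} = P`). Hence `γ P'/P` is the sum of the two fibrewise Stokes elements
`Dⱼ − (Gⱼ|_{xⱼ=1} − Gⱼ|_{xⱼ=0}) = Dⱼ`, carried by the closed square with the continuous (hence
integrable) `ℚ`-semialgebraic integrands `Dⱼ`; `Gⱼ` is bounded on the compact square by continuity.
Semialgebraicity is closure of `ℚ`-semialgebraic functions under field operations
(Bochnak–Coste–Roy, Prop. 2.2.6) applied to the atoms `P (x 0)`, `P' (x 0)`, `x 1`, `γ`, `1`.

References: J. Ayoub, *Une version relative de la conjecture des périodes de Kontsevich–Zagier*,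
Ann. of Math. 181 (2015), Rem. 1.5; M. Kontsevich, D. Zagier, *Periods* (2001), §1.2;
J. Bochnak, M. Coste, M.-F. Roy, *Real Algebraic Geometry* (1998), Prop. 2.2.6.
-/

noncomputable section

-- `Summit.KontsevichZagierPeriods.KontsevichZagierPeriods.…` is the tree's mandated layout (single-conjunct summit).
set_option linter.dupNamespace false

namespace Summit.KontsevichZagierPeriods.KontsevichZagierPeriods.Cruxes.StokesGeneration.FibrewiseStokes

open MeasureTheory Set
open Literature.NumberTheory.Transcendental
open Literature.NumberTheory.Transcendental.KZ
open Literature.ModelTheory.ExponentialFields (IsSemialgebraic)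

/-! ## Calculus of the two primitives along their fibres -/

/-- Direction `0`: `d/du [γ (P u − 1)/(1 + (P u − 1) y)] = γ P'(u)/(1 + (P u − 1) y)²`
(quotient rule; the `y`-terms cancel in the numerator). [folklore] -/
theorem rungCert_hasDerivAt_dir0 {γ y s e : ℝ} {P : ℝ → ℝ} (hP : HasDerivAt P e s)
    (hE : 1 + (P s - 1) * y ≠ 0) :
    HasDerivAt (fun u => γ * (P u - 1) / (1 + (P u - 1) * y))
      (γ * e / (1 + (P s - 1) * y) ^ 2) s := by
  refine (((hP.sub_const 1).const_mul γ).fun_div (((hP.sub_const 1).mul_const y).const_add 1)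
    hE).congr_deriv ?_
  congr 1
  ring

/-- Direction `1`: `d/du [γ u a (1/p − 1/(1 + c u))] = γ a (1/p − 1/(1 + c u)²)` wherever
`1 + c u ≠ 0` (product and quotient rules; `1/(1 + c u) − c u/(1 + c u)² = 1/(1 + c u)²`).
[folklore] -/
theorem rungCert_hasDerivAt_dir1 {γ a p c s : ℝ} (hE : 1 + c * s ≠ 0) :
    HasDerivAt (fun u => γ * u * a * (1 / p - 1 / (1 + c * u)))
      (γ * a * (1 / p - 1 / (1 + c * s) ^ 2)) s := by
  have h1 : HasDerivAt (fun u => 1 + c * u) (c * 1) s :=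
    ((hasDerivAt_id' s).const_mul c).const_add 1
  have h2 : HasDerivAt (fun u => γ * u * a) (γ * 1 * a) s :=
    ((hasDerivAt_id' s).const_mul γ).mul_const a
  refine (h2.fun_mul ((hasDerivAt_const s (1 / p)).fun_sub
    ((hasDerivAt_const s (1:ℝ)).fun_div h1 hE))).congr_deriv ?_
  generalize hF : 1 + c * s = F at hE ⊢
  linear_combination (γ * a * F⁻¹) * mul_inv_cancel₀ hE + (γ * a * F⁻¹ ^ 2) * hF

/-! ## The certificate -/

/-- **Registered stub `stub_rungCertificate` (rung R2): the two-element divergence certificate for a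
logarithmic derivative.** If `P > 0` on `[0,1]`, `P(0) = P(1) = 1`, `P` is differentiable on `(0,1)`
with derivative `P'`, both continuous on `[0,1]` and `ℚ`-semialgebraic (as functions of `x 0` on the
square), and `γ` is real algebraic, then `γ · P'/P` (a function of `x 0` on `[0,1]²`) is the sum of
two fibrewise Stokes elements with primitives `G₀ = γ (P − 1)/(1 + (P − 1) x₁)` (direction `0`) and
`G₁ = γ x₁ P' (1/P − 1/(1 + (P − 1) x₁))` (direction `1`), no kink set; all four boundary terms
vanish and `∂₀ G₀ + ∂₁ G₁ = γ P'/P`. [cite: Ayoub2015, Rem. 1.5] -/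
theorem stub_rungCertificate :
    ∀ (γ : ℝ) (P P' : ℝ → ℝ), IsAlgebraic ℚ γ →
      IsSemialgebraicFunOn ℚ (Set.pi Set.univ (fun _ : Fin 2 => Set.Icc (0:ℝ) 1)) (fun x => P (x 0)) →
      IsSemialgebraicFunOn ℚ (Set.pi Set.univ (fun _ : Fin 2 => Set.Icc (0:ℝ) 1)) (fun x => P' (x 0)) →
      (∀ u ∈ Set.Icc (0:ℝ) 1, 0 < P u) → P 0 = 1 → P 1 = 1 →
      ContinuousOn P (Set.Icc (0:ℝ) 1) → ContinuousOn P' (Set.Icc (0:ℝ) 1) →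
      (∀ u ∈ Set.Ioo (0:ℝ) 1, HasDerivAt P (P' u) u) →
      ∃ (G D : Fin 2 → (Fin 2 → ℝ) → ℝ) (q : Fin 2 → IntegralRep 2),
        (∀ j, IsSemialgebraicFunOn ℚ (Set.pi Set.univ (fun _ : Fin 2 => Set.Icc (0:ℝ) 1)) (G j) ∧
          IsSemialgebraicFunOn ℚ (Set.pi Set.univ (fun _ : Fin 2 => Set.Icc (0:ℝ) 1)) (D j) ∧
          (∃ B : ℝ, ∀ x ∈ Set.pi Set.univ (fun _ : Fin 2 => Set.Icc (0:ℝ) 1), |(G j) x| ≤ B) ∧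
          (∀ x ∈ Set.pi Set.univ (fun _ : Fin 2 => Set.Icc (0:ℝ) 1),
            ContinuousOn (fun s : ℝ => (G j) (Function.update x j s)) (Set.Icc (0:ℝ) 1)) ∧
          (∀ x ∈ Set.pi Set.univ (fun _ : Fin 2 => Set.Icc (0:ℝ) 1), x j ∈ Set.Ioo (0:ℝ) 1 →
            HasDerivAt (fun s : ℝ => (G j) (Function.update x j s)) ((D j) x) (x j))) ∧
        (∀ j, (q j).domain = Set.pi Set.univ (fun _ : Fin 2 => Set.Icc (0:ℝ) 1) ∧
          ∀ x ∈ Set.pi Set.univ (fun _ : Fin 2 => Set.Icc (0:ℝ) 1), (q j).integrand x =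
            D j x - (G j (Function.update x j 1) - G j (Function.update x j 0))) ∧
        ∀ x ∈ Set.pi Set.univ (fun _ : Fin 2 => Set.Icc (0:ℝ) 1),
          γ * (P' (x 0) / P (x 0)) = ∑ j, (q j).integrand x := by
  intro γ P P' hγ hP hP' hpos hP0 hP1 hPc hP'c hder
  -- the closed square and what holds on it
  set S : Set (Fin 2 → ℝ) := Set.pi Set.univ (fun _ : Fin 2 => Set.Icc (0:ℝ) 1) with hS
  have hSsa : IsSemialgebraic ℚ S := by rw [hS, ← cube_eq_pi]; exact isSemialgebraic_cube
  have hSc : IsCompact S := isCompact_univ_pi fun _ => isCompact_Icc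
  have h10 : (1 : Fin 2) ≠ 0 := by decide
  have h01 : (0 : Fin 2) ≠ 1 := by decide
  have hmem : ∀ x ∈ S, ∀ i, x i ∈ Set.Icc (0:ℝ) 1 := fun x hx i => (Set.mem_univ_pi.mp hx) i
  have hPpos : ∀ x ∈ S, 0 < P (x 0) := fun x hx => hpos _ (hmem x hx 0)
  have hPne : ∀ x ∈ S, P (x 0) ≠ 0 := fun x hx => (hPpos x hx).ne'
  have hEpos : ∀ x ∈ S, 0 < 1 + (P (x 0) - 1) * x 1 := by
    intro x hx
    obtain ⟨h1l, h1u⟩ := hmem x hx 1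
    have hp := hPpos x hx
    rcases le_total 1 (P (x 0)) with h | h
    · nlinarith [mul_nonneg (sub_nonneg.2 h) h1l]
    · nlinarith [mul_nonneg (sub_nonneg.2 h) (sub_nonneg.2 h1u)]
  have hEne : ∀ x ∈ S, 1 + (P (x 0) - 1) * x 1 ≠ 0 := fun x hx => (hEpos x hx).ne'
  have hE2ne : ∀ x ∈ S, (1 + (P (x 0) - 1) * x 1) ^ 2 ≠ 0 := fun x hx =>
    pow_ne_zero 2 (hEne x hx)
  -- moving one coordinate inside `[0,1]` stays in the square
  have hupd : ∀ x ∈ S, ∀ (j : Fin 2), ∀ s ∈ Set.Icc (0:ℝ) 1, Function.update x j s ∈ S := by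
    intro x hx j s hs
    refine Set.mem_univ_pi.mpr fun i => ?_
    rcases eq_or_ne i j with rfl | hij
    · simpa using hs
    · rw [Function.update_of_ne hij]
      exact hmem x hx i
  -- semialgebraic atoms on the square
  have hx1sa : IsSemialgebraicFunOn ℚ S (fun x => x 1) := isSemialgebraicFunOn_apply hSsa 1
  have hγsa : IsSemialgebraicFunOn ℚ S (fun _ => γ) :=
    isSemialgebraicFunOn_const_of_isAlgebraic hSsa hγ
  have h1sa : IsSemialgebraicFunOn ℚ S (fun _ => (1:ℝ)) :=
    isSemialgebraicFunOn_const_of_isAlgebraic hSsa isAlgebraic_one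
  have hEsa : IsSemialgebraicFunOn ℚ S (fun x => 1 + (P (x 0) - 1) * x 1) :=
    h1sa.fun_add ((hP.fun_sub h1sa).fun_mul hx1sa)
  -- continuity atoms on the square
  have hPS : ContinuousOn (fun x : Fin 2 → ℝ => P (x 0)) S :=
    hPc.comp (continuous_apply 0).continuousOn fun x hx => hmem x hx 0
  have hP'S : ContinuousOn (fun x : Fin 2 → ℝ => P' (x 0)) S :=
    hP'c.comp (continuous_apply 0).continuousOn fun x hx => hmem x hx 0
  have hx1S : ContinuousOn (fun x : Fin 2 → ℝ => x 1) S := (continuous_apply 1).continuousOn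
  have hES : ContinuousOn (fun x : Fin 2 → ℝ => 1 + (P (x 0) - 1) * x 1) S :=
    continuousOn_const.fun_add ((hPS.fun_sub continuousOn_const).fun_mul hx1S)
  have hE2S : ContinuousOn (fun x : Fin 2 → ℝ => (1 + (P (x 0) - 1) * x 1) ^ 2) S :=
    hES.pow 2
  -- the witnesses
  set G0 : (Fin 2 → ℝ) → ℝ := fun x => γ * (P (x 0) - 1) / (1 + (P (x 0) - 1) * x 1) with hG0
  set D0 : (Fin 2 → ℝ) → ℝ := fun x => γ * P' (x 0) / (1 + (P (x 0) - 1) * x 1) ^ 2 with hD0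
  set G1 : (Fin 2 → ℝ) → ℝ := fun x =>
    γ * x 1 * P' (x 0) * (1 / P (x 0) - 1 / (1 + (P (x 0) - 1) * x 1)) with hG1
  set D1 : (Fin 2 → ℝ) → ℝ := fun x =>
    γ * P' (x 0) * (1 / P (x 0) - 1 / (1 + (P (x 0) - 1) * x 1) ^ 2) with hD1
  -- semialgebraicity (closure under field operations, BCR Prop. 2.2.6)
  have hG0sa : IsSemialgebraicFunOn ℚ S G0 := (hγsa.fun_mul (hP.fun_sub h1sa)).div hEsa hEne
  have hD0sa : IsSemialgebraicFunOn ℚ S D0 := (hγsa.fun_mul hP').div (hEsa.fun_pow 2) hE2ne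
  have hG1sa : IsSemialgebraicFunOn ℚ S G1 :=
    ((hγsa.fun_mul hx1sa).fun_mul hP').fun_mul
      ((h1sa.div hP hPne).fun_sub (h1sa.div hEsa hEne))
  have hD1sa : IsSemialgebraicFunOn ℚ S D1 :=
    (hγsa.fun_mul hP').fun_mul ((h1sa.div hP hPne).fun_sub (h1sa.div (hEsa.fun_pow 2) hE2ne))
  -- continuity on the square
  have hG0c : ContinuousOn G0 S :=
    (continuousOn_const.fun_mul (hPS.fun_sub continuousOn_const)).div₀ hES hEne
  have hD0c : ContinuousOn D0 S := (continuousOn_const.fun_mul hP'S).div₀ hE2S hE2ne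
  have hG1c : ContinuousOn G1 S :=
    ((continuousOn_const.fun_mul hx1S).fun_mul hP'S).fun_mul
      ((continuousOn_const.div₀ hPS hPne).fun_sub (continuousOn_const.div₀ hES hEne))
  have hD1c : ContinuousOn D1 S :=
    (continuousOn_const.fun_mul hP'S).fun_mul
      ((continuousOn_const.div₀ hPS hPne).fun_sub (continuousOn_const.div₀ hE2S hE2ne))
  -- packaged as `Fin 2`-families
  set G : Fin 2 → (Fin 2 → ℝ) → ℝ := ![G0, G1] with hG
  set D : Fin 2 → (Fin 2 → ℝ) → ℝ := ![D0, D1] with hD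
  have hGsa : ∀ j, IsSemialgebraicFunOn ℚ S (G j) := Fin.forall_fin_two.2 ⟨hG0sa, hG1sa⟩
  have hDsa : ∀ j, IsSemialgebraicFunOn ℚ S (D j) := Fin.forall_fin_two.2 ⟨hD0sa, hD1sa⟩
  have hGc : ∀ j, ContinuousOn (G j) S := Fin.forall_fin_two.2 ⟨hG0c, hG1c⟩
  have hDc : ∀ j, ContinuousOn (D j) S := Fin.forall_fin_two.2 ⟨hD0c, hD1c⟩
  -- all four boundary values vanish identically
  have hG_one : ∀ j x, G j (Function.update x j 1) = 0 := by
    refine Fin.forall_fin_two.2 ⟨fun x => ?_, fun x => ?_⟩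
    · simp only [hG, hG0, Matrix.cons_val_zero, Function.update_self, hP1]
      ring
    · simp only [hG, hG1, Matrix.cons_val_one, Matrix.cons_val_fin_one, Function.update_self,
        Function.update_of_ne h01]
      ring
  have hG_zero : ∀ j x, G j (Function.update x j 0) = 0 := by
    refine Fin.forall_fin_two.2 ⟨fun x => ?_, fun x => ?_⟩
    · simp only [hG, hG0, Matrix.cons_val_zero, Function.update_self, hP0]
      ring
    · simp only [hG, hG1, Matrix.cons_val_one, Matrix.cons_val_fin_one, Function.update_self]
      ring
  -- bounds on the compact square
  have hGbd : ∀ j, ∃ B : ℝ, ∀ x ∈ S, |G j x| ≤ B := fun j => by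
    obtain ⟨B, hB⟩ := hSc.exists_bound_of_continuousOn (hGc j)
    exact ⟨B, fun x hx => by simpa only [Real.norm_eq_abs] using hB x hx⟩
  -- continuity along closed fibres
  have hGfib : ∀ j, ∀ x ∈ S,
      ContinuousOn (fun s : ℝ => G j (Function.update x j s)) (Set.Icc (0:ℝ) 1) := by
    intro j x hx
    have hc : Continuous fun s : ℝ => Function.update x j s :=
      continuous_const.update j continuous_id
    exact (hGc j).comp hc.continuousOn fun s hs => hupd x hx j s hs
  -- derivatives along open fibres
  have hGder : ∀ j, ∀ x ∈ S, x j ∈ Set.Ioo (0:ℝ) 1 →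
      HasDerivAt (fun s : ℝ => G j (Function.update x j s)) (D j x) (x j) := by
    refine Fin.forall_fin_two.2 ⟨fun x hx hx0 => ?_, fun x hx _ => ?_⟩
    · have hfun : (fun s : ℝ => G 0 (Function.update x 0 s)) =
          fun s => γ * (P s - 1) / (1 + (P s - 1) * x 1) := by
        funext s
        simp only [hG, hG0, Matrix.cons_val_zero, Function.update_self, Function.update_of_ne h10]
      have hDx : D 0 x = γ * P' (x 0) / (1 + (P (x 0) - 1) * x 1) ^ 2 := by
        simp only [hD, hD0, Matrix.cons_val_zero]
      rw [hfun, hDx]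
      exact rungCert_hasDerivAt_dir0 (hder _ hx0) (hEne x hx)
    · have hfun : (fun s : ℝ => G 1 (Function.update x 1 s)) =
          fun s => γ * s * P' (x 0) * (1 / P (x 0) - 1 / (1 + (P (x 0) - 1) * s)) := by
        funext s
        simp only [hG, hG1, Matrix.cons_val_one, Matrix.cons_val_fin_one, Function.update_self,
          Function.update_of_ne h01]
      have hDx : D 1 x = γ * P' (x 0) * (1 / P (x 0) - 1 / (1 + (P (x 0) - 1) * x 1) ^ 2) := by
        simp only [hD, hD1, Matrix.cons_val_one, Matrix.cons_val_fin_one]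
      rw [hfun, hDx]
      exact rungCert_hasDerivAt_dir1 (hEne x hx)
  -- the two closed-square representations, with integrands `D j`
  let q : Fin 2 → IntegralRep 2 := fun j =>
    { domain := S
      integrand := D j
      isSemialgebraic_domain := hSsa
      isSemialgebraicFunOn_integrand := hDsa j
      integrableOn := (hDc j).integrableOn_compact hSc }
  refine ⟨G, D, q, fun j => ⟨hGsa j, hDsa j, hGbd j, hGfib j, hGder j⟩,
    fun j => ⟨rfl, fun x _ => ?_⟩, fun x hx => ?_⟩
  · -- the integrand clause: boundary terms vanish
    show D j x = D j x - (G j (Function.update x j 1) - G j (Function.update x j 0))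
    rw [hG_one, hG_zero, sub_zero, sub_zero]
  · -- the identity `γ P'/P = D₀ + D₁`
    show γ * (P' (x 0) / P (x 0)) = ∑ j, D j x
    rw [Fin.sum_univ_two]
    simp only [hD, hD0, hD1, Matrix.cons_val_zero, Matrix.cons_val_one, Matrix.cons_val_fin_one]
    ring

end Summit.KontsevichZagierPeriods.KontsevichZagierPeriods.Cruxes.StokesGeneration.FibrewiseStokes
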